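import Literature.Geometry.Kaehler.ComplexTorusEuclideanPresentation
import HarnessLib

/-!
# The explicit complex torus of Weil type carries no analytic curve: `B³(X) = H⁶(X, ℚ) ∩ H^{3,3} = 0`

Layer `Literature/Geometry/Kaehler`; lane `lit-hodgefound` (Track 2 foundations library), Layer A4, row A4-107 of
`run/shared/lean/pub/lit-hodgefound/SKELETON.md` (seat skel-4). Sequel of `ComplexTorusEuclideanPresentation.lean`
(§4: the explicit torus of Weil type `X = ℂ⁴/Φ(ℤ⁸)`, `Φ = Weil.periodEquiv`, carries no analytic HYPERSURFACE, from
`NS(X) ⊗ ℚ = 0`) and of `ComplexTorusWeilNeronSeveri.lean` (the transcendence computation `NS(X) ⊗ ℚ = 0`). Here the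
other end of the dimension range: **`X` carries no analytic CURVE**, because the rational Hodge classes of degree
`6 = 2g - 2`, `B³(X) = H⁶(X, ℚ) ∩ H^{3,3}(X)`, vanish — a second transcendence computation on the explicit period
matrix. This is the curve case of Voisin's assumption (b) of IMRN 2002 §2 ("`X` does not contain proper closed
analytic subsets of positive dimension") for the tree's explicit member of her family of §3, obtained here not from
Ueno's structure theory (the route printed on p. 1063) but from the cycle class: the class of a curve would be a
non-zero element of `H⁶(X, ℤ) ∩ H^{3,3}` (Lelong; Griffiths–Harris Ch. 0 §2, Ch. 3 §1; the tree's obstruction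
`ComplexTorus.not_hasPureDim_of_hodgeClasses_eq_bot`, any model).

## The method (Voisin, *Hodge Theory I*, Lemma 7.30, in degree `2g - 2`)

For a complex torus `X = E/Φ(ℤ^ι)` of dimension `g` (`rk Λ = n = 2g`) the cup-product pairing
`⟨·, ·⟩_e : H^{n-2}(X, ℂ) × H²(X, ℂ) → ℂ` is perfect (`ComplexTorusPoincareDuality.lean`), and a class `δ` of type
`(g-1, g-1)` pairs to zero with every class of type `(r, s)`, `r ≠ s` (types add; top forms are of type `(g, g)`:
Voisin 2002, proof of Lemma 7.30, the tree's `wedge_eq_zero_of_isOfTypeAt_self`). Expanding a `2`-form in the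
coordinate forms `ε_{ab} = dxₐ ∧ dx_b` (`two_smul_eq_sum_coordForm`: `2α = Σ_{a,b} α(λₐ, λ_b) ε_{ab}`) gives

  `2 ⟨δ, α⟩ = Σ_{a,b} α(λₐ, λ_b) · Q_{ab}`,  `Q_{ab} := ⟨δ, ε_{ab}⟩`  (`sum_sum_apply_mul_poincarePairing_coordForm`),

with `Q` antisymmetric, RATIONAL when `δ` is a rational class (`⟨H(ℚ), H(ℚ)⟩ ⊆ ℚ`), and `δ = 0` as soon as all
`Q_{ab}` vanish (perfectness; `eq_zero_of_forall_poincarePairing_coordForm_eq_zero`). Hence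
(`hodgeClassesIn_eq_bot_of_forall`): **if the only antisymmetric rational matrix `Q` with
`Σ_{a,b} α(λₐ, λ_b) Q_{ab} = 0` for every `(2,0)`-form `α` is `Q = 0`, then `X` has no non-zero rational class of
type `(p, p)` in degree `n - 2`** — `Q` is the Poincaré-dual rational `2`-cycle of `δ`, and the condition says that
it is annihilated by the holomorphic `2`-forms (Lemma 7.30: `H^{g-1,g-1} = (H^{2,0} ⊕ H^{0,2})^⊥`).

## The computation (§4)

For `X = ℂ⁴/Φ(ℤ⁸)` with the period matrix of `Weil.periodEquiv_single` (transcendental parameter `t = Weil.tV`) we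
test against the holomorphic `2`-forms `dz_j ∧ dz_k` (`Weil.holTwoForm`, of type `(2,0)`) for
`(j,k) = (0,1), (0,2), (0,3), (1,2)`: each identity `Σ_{a<b} (λₐʲ λ_bᵏ - λ_bʲ λₐᵏ) Q_{ab} = 0` reads
`A(t) + i B(t) = 0` with `A, B ∈ ℚ[t]` whose coefficients are `ℚ`-linear forms in the `28` unknowns `Q_{ab}`,
`a < b`; since `t` is real and transcendental every coefficient vanishes (`Weil.eq_zero_of_sum_add_I_mul_sum_eq_zero`),
and the resulting `60` linear equations force `Q = 0` (the exponents `1, 2, 3, 5; 10, 20, 30, 50` of the period matrix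
were chosen so that few monomials collide). Whence **`Weil.hodgeClasses_three_eq_bot : B³(X) = 0`**, and by the
cycle-class obstruction **`Weil.not_hasPureDim_one`** (no closed analytic subset of pure dimension one: NO ANALYTIC
CURVE on `X`) and `Weil.not_hasPureCodim_three`. (With §4 of `ComplexTorusEuclideanPresentation`: `X` has neither
curves nor hypersurfaces; surfaces are the subject of the sequel, where `B²(X)` is the `ℚ`-plane of Weil classes.)

Definitions `Weil.dzForm`, `Weil.holTwoForm` (explicit forms on `ℂ⁴`); theorems otherwise; no named fact, no
instance, no notation.

## References

* [VoisinHodgeI2002] C. Voisin, *Hodge Theory and Complex Algebraic Geometry I* (2002), §7.3.2 Lemma 7.30 (PDF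
  p. 151), §11.1.2 Cor. 11.15, §11.1.3 Prop. 11.20 (the class of an analytic subset is an integral Hodge class).
* [Voisin2002KaehlerCounterexample] C. Voisin, IMRN 2002 no. 20, 1057–1075, §2 (a)–(b), §3 p. 1063 and Prop. 3.
* [Lange2023AbelianVarietiesComplex] H. Lange, *Abelian Varieties over the Complex Numbers* (2023), §1.1.4
  Prop. 1.1.20, §6.2.4 (p. 310: Poincaré duality), §2.1.6 Exercise (8)(g).
* [GriffithsHarrisPrinciples1978] P. Griffiths, J. Harris, *Principles of Algebraic Geometry* (1978), Ch. 0 §2,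
  Ch. 3 §1 (fundamental classes of analytic subvarieties).
-/

noncomputable section

open scoped Manifold
open Complex Module Set Function Finset
open Literature.Analysis.Complex

namespace Literature.Geometry.Kaehler

namespace ComplexTorus

section General

variable {ι : Type*} [DecidableEq ι] {E : Type*} [NormedAddCommGroup E] [NormedSpace ℂ E]
  (Φ : (ι → ℝ) ≃L[ℝ] E) {n k : ℕ} (e : Fin n ≃ ι) (h : k + 2 = n)

/-! ### §1 Classes of degree `n - 2` against the coordinate `2`-forms (Voisin I, Lemma 7.30) -/

/-- **Expansion of the cup-product pairing against a `2`-form in lattice coordinates**: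
`Σ_{a,b} α(λₐ, λ_b) · ⟨δ, ε_{ab}⟩ = 2 ⟨δ, α⟩` (from `2α = Σ_{a,b} α(λₐ, λ_b) ε_{ab}` and bilinearity).
[cite: Lange2023AbelianVarietiesComplex, §1.1.4 Prop. 1.1.20 and §6.2.4 (p. 310)] -/
theorem sum_sum_apply_mul_poincarePairing_coordForm [Fintype ι] (δ : E [⋀^Fin k]→L[ℝ] ℂ) (α : E [⋀^Fin 2]→L[ℝ] ℂ) :
    ∑ a, ∑ b, α ![Φ (Pi.single a 1), Φ (Pi.single b 1)] * poincarePairing Φ e h δ (coordForm Φ a b) =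
      2 * poincarePairing Φ e h δ α := by
  have h2 : poincarePairing Φ e h δ ((2 : ℂ) • α) = 2 * poincarePairing Φ e h δ α := by
    rw [map_smul, smul_eq_mul]
  rw [← h2, two_smul_eq_sum_coordForm Φ α, map_sum]
  refine Finset.sum_congr rfl fun a _ ↦ ?_
  rw [map_sum]
  refine Finset.sum_congr rfl fun b _ ↦ ?_
  rw [map_smul, smul_eq_mul]

/-- **Type orthogonality** (Voisin I, proof of Lemma 7.30): a class of type `(p, p)` in degree `n - 2` pairs to zero
with every `2`-form of type `(r, s)`, `r ≠ s` — the wedge is a top form of type `(p + r, p + s) ≠ (g, g)`.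
[cite: VoisinHodgeI2002, §7.3.2 Lemma 7.30] -/
theorem poincarePairing_eq_zero_of_isOfTypeAt_two [Fintype ι] [FiniteDimensional ℂ E] {p r s : ℕ} {δ : E [⋀^Fin k]→L[ℝ] ℂ}
    {α : E [⋀^Fin 2]→L[ℝ] ℂ} (hδ : IsOfTypeAt p p δ) (hα : IsOfTypeAt r s α) (hrs : r ≠ s) :
    poincarePairing Φ e h δ α = 0 := by
  have hfin : finrank ℂ E + finrank ℂ E = k + 2 := by
    have h1 := finrank_complex_mul_two Φ e
    omega
  rw [poincarePairing_apply, wedge_eq_zero_of_isOfTypeAt_self hδ hα hfin hrs, ContinuousAlternatingMap.coe_zero,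
    Pi.zero_apply]

/-- Hence `Σ_{a,b} α(λₐ, λ_b) ⟨δ, ε_{ab}⟩ = 0` for `δ` of type `(p, p)` and `α` of type `(r, s)`, `r ≠ s` — the
Poincaré-dual `2`-cycle `(⟨δ, ε_{ab}⟩)_{a,b}` of `δ` is annihilated by the off-type `2`-forms.
[cite: VoisinHodgeI2002, §7.3.2 Lemma 7.30] -/
theorem sum_sum_apply_mul_poincarePairing_coordForm_eq_zero [Fintype ι] [FiniteDimensional ℂ E] {p r s : ℕ} {δ : E [⋀^Fin k]→L[ℝ] ℂ}
    {α : E [⋀^Fin 2]→L[ℝ] ℂ} (hδ : IsOfTypeAt p p δ) (hα : IsOfTypeAt r s α) (hrs : r ≠ s) :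
    ∑ a, ∑ b, α ![Φ (Pi.single a 1), Φ (Pi.single b 1)] * poincarePairing Φ e h δ (coordForm Φ a b) = 0 := by
  rw [sum_sum_apply_mul_poincarePairing_coordForm, poincarePairing_eq_zero_of_isOfTypeAt_two Φ e h hδ hα hrs,
    mul_zero]

/-- **Perfectness in lattice coordinates**: a class `δ` of degree `n - 2` with `⟨δ, ε_{ab}⟩ = 0` for all `a, b` is
zero (the `ε_{ab}` span `H²(X, ℂ)`; the cup-product pairing is perfect). [cite: Lange2023AbelianVarietiesComplex, §6.2.4 (p. 310)] -/
theorem eq_zero_of_forall_poincarePairing_coordForm_eq_zero [Fintype ι] {δ : E [⋀^Fin k]→L[ℝ] ℂ}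
    (hδ : ∀ a b, poincarePairing Φ e h δ (coordForm Φ a b) = 0) : δ = 0 := by
  refine eq_zero_of_forall_right_poincarePairing_eq_zero Φ e h fun α ↦ ?_
  have h2 := sum_sum_apply_mul_poincarePairing_coordForm Φ e h δ α
  simp only [hδ, mul_zero, Finset.sum_const_zero] at h2
  exact (mul_eq_zero.1 h2.symm).resolve_left two_ne_zero

/-- The pairings `⟨δ, ε_{ab}⟩` of a RATIONAL class `δ` are rational numbers (`⟨H(ℚ), H(ℚ)⟩ ⊆ ℚ`; the `ε_{ab}` are
integral classes). [cite: Lange2023AbelianVarietiesComplex, §6.2.4 (p. 310)] -/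
theorem exists_rat_poincarePairing_coordForm_eq {δ : E [⋀^Fin k]→L[ℝ] ℂ} (hδ : δ ∈ rationalForms Φ k)
    (a b : ι) : ∃ q : ℚ, poincarePairing Φ e h δ (coordForm Φ a b) = q :=
  poincarePairing_mem_range_rat Φ e h hδ
    (mem_rationalForms_of_mem_integralForms Φ (coordForm_mem_integralForms Φ a b))

include e h in
/-- **The criterion (Voisin I, Lemma 7.30 in degree `2g - 2`, through the rational Poincaré-dual `2`-cycle).** If the
only antisymmetric RATIONAL matrix `Q = (Q_{ab})` with `Σ_{a,b} α(λₐ, λ_b) Q_{ab} = 0` for every `2`-form `α` of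
type `(2, 0)` is `Q = 0`, then the torus `X = E/Φ(ℤ^ι)` has no non-zero rational class of type `(p, p)` in degree
`n - 2` (`hodgeClassesIn Φ (n-2) p = 0`; for `2p = n - 2` this is `B^{g-1}(X) = H^{2g-2}(X, ℚ) ∩ H^{g-1,g-1} = 0`):
for such a class `δ`, `Q_{ab} = ⟨δ, ε_{ab}⟩` is such a matrix, and `Q = 0` forces `δ = 0`.
[cite: VoisinHodgeI2002, §7.3.2 Lemma 7.30] [cite: Lange2023AbelianVarietiesComplex, §6.2.4 (p. 310)] -/
theorem hodgeClassesIn_eq_bot_of_forall [Fintype ι] [FiniteDimensional ℂ E] {p : ℕ}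
    (H : ∀ Q : ι → ι → ℚ, (∀ a b, Q b a = -Q a b) →
      (∀ α : E [⋀^Fin 2]→L[ℝ] ℂ, IsOfTypeAt 2 0 α →
        ∑ a, ∑ b, α ![Φ (Pi.single a 1), Φ (Pi.single b 1)] * (Q a b : ℂ) = 0) → ∀ a b, Q a b = 0) :
    hodgeClassesIn Φ k p = ⊥ := by
  refine (Submodule.eq_bot_iff _).2 fun δ hδ ↦ ?_
  by_cases hk : p + p = k
  · obtain ⟨hrat, htyp⟩ := (mem_hodgeClassesIn_iff Φ).1 hδ
    have hT : IsOfTypeAt p p δ := (mem_typeSubmodule_iff_isOfTypeAt hk).1 htyp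
    choose Q hQ using fun a b ↦ exists_rat_poincarePairing_coordForm_eq Φ e h hrat a b
    have hanti : ∀ a b, Q b a = -Q a b := fun a b ↦ by
      have h1 := hQ b a
      rw [coordForm_swap Φ a b, map_neg, hQ a b] at h1
      exact_mod_cast h1.symm
    have hzero := H Q hanti fun α hα ↦ by
      have h1 := sum_sum_apply_mul_poincarePairing_coordForm_eq_zero Φ e h hT hα (by norm_num)
      simpa only [hQ] using h1
    exact eq_zero_of_forall_poincarePairing_coordForm_eq_zero Φ e h fun a b ↦ by
      rw [hQ, hzero, Rat.cast_zero]
  · rw [hodgeClassesIn_eq_bot_of_ne Φ hk] at hδ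
    exact (Submodule.mem_bot ℚ).1 hδ

end General

end ComplexTorus

namespace Weil

open ComplexTorus

/-! ### §2 Transcendence with Gaussian-rational coefficients: `A(t) + i B(t) = 0 ⇒ A = B = 0` coefficientwise -/

/-- **Real and imaginary parts separate**: if `Σ_{n ∈ S} αₙ τⁿ + i Σ_{n ∈ S'} βₙ τⁿ = 0` for a REAL number `τ`
transcendental over `ℚ` and rational `αₙ, βₙ`, then all `αₙ` (`n ∈ S`) and all `βₙ` (`n ∈ S'`) vanish: both sums
are real, so each vanishes, and distinct powers of `τ` are `ℚ`-linearly independent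
(`eq_zero_of_sum_mul_pow_eq_zero`). Private helper of the computation below. [folklore] -/
private theorem eq_zero_of_sum_add_I_mul_sum_eq_zero {τ : ℝ} (hτ : Transcendental ℚ (τ : ℂ)) (S S' : Finset ℕ)
    (α β : ℕ → ℚ)
    (h : (∑ n ∈ S, ((α n : ℚ) : ℂ) * (τ : ℂ) ^ n) + I * (∑ n ∈ S', ((β n : ℚ) : ℂ) * (τ : ℂ) ^ n) = 0) :
    (∀ n ∈ S, α n = 0) ∧ ∀ n ∈ S', β n = 0 := by
  set A : ℝ := ∑ n ∈ S, ((α n : ℚ) : ℝ) * τ ^ n with hA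
  set B : ℝ := ∑ n ∈ S', ((β n : ℚ) : ℝ) * τ ^ n with hB
  have hAc : ((A : ℝ) : ℂ) = ∑ n ∈ S, ((α n : ℚ) : ℂ) * (τ : ℂ) ^ n := by
    rw [hA]; push_cast; rfl
  have hBc : ((B : ℝ) : ℂ) = ∑ n ∈ S', ((β n : ℚ) : ℂ) * (τ : ℂ) ^ n := by
    rw [hB]; push_cast; rfl
  rw [← hAc, ← hBc] at h
  have hre := congrArg Complex.re h
  have him := congrArg Complex.im h
  simp only [Complex.add_re, Complex.add_im, Complex.mul_re, Complex.mul_im, Complex.I_re, Complex.I_im,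
    Complex.ofReal_re, Complex.ofReal_im, Complex.zero_re, Complex.zero_im, zero_mul, one_mul, mul_zero,
    sub_zero, zero_add, add_zero] at hre him
  refine ⟨eq_zero_of_sum_mul_pow_eq_zero hτ S α ?_, eq_zero_of_sum_mul_pow_eq_zero hτ S' β ?_⟩
  · rw [← hAc, hre, Complex.ofReal_zero]
  · rw [← hBc, him, Complex.ofReal_zero]

/-! ### §3 The holomorphic `2`-forms `dz_j ∧ dz_k` on `ℂ⁴` -/

/-- The holomorphic coordinate `1`-form `dz_j` on `ℂ⁴ = Fin 4 → ℂ`, as a constant alternating `1`-form.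
[cite: Voisin2002KaehlerCounterexample, §3 p. 5] -/
def dzForm (j : Fin 4) : (Fin 4 → ℂ) [⋀^Fin 1]→L[ℝ] ℂ :=
  ContinuousAlternatingMap.ofSubsingleton ℝ (Fin 4 → ℂ) ℂ (0 : Fin 1) (dz j)

/-- `dz_j(v) = (v₀)_j`. [cite: Voisin2002KaehlerCounterexample, §3 p. 5] -/
@[simp] theorem dzForm_apply (j : Fin 4) (v : Fin 1 → (Fin 4 → ℂ)) : dzForm j v = v 0 j := by
  simp [dzForm]

/-- **The holomorphic `2`-form `dz_j ∧ dz_k`** on `ℂ⁴` (a basis of `H^{2,0}(X) = ⋀² V^*` for `j < k`).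
[cite: Voisin2002KaehlerCounterexample, §3 p. 6] -/
def holTwoForm (j k : Fin 4) : (Fin 4 → ℂ) [⋀^Fin 2]→L[ℝ] ℂ := (dzForm j).wedge (dzForm k)

/-- `(dz_j ∧ dz_k)(u, v) = u_j v_k - v_j u_k`. [cite: Voisin2002KaehlerCounterexample, §3 p. 6] -/
theorem holTwoForm_apply (j k : Fin 4) (v : Fin 2 → (Fin 4 → ℂ)) :
    holTwoForm j k v = v 0 j * v 1 k - v 1 j * v 0 k := by
  rw [holTwoForm, ContinuousAlternatingMap.wedge_apply_one_one]
  simp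

/-- `dz_j ∧ dz_k` is of type `(2, 0)`: `(dz_j ∧ dz_k)(e^{iθ}u, e^{iθ}v) = e^{2iθ} (dz_j ∧ dz_k)(u, v)`.
[cite: VoisinHodgeI2002, §7.3.2 Lemma 7.30] -/
theorem isOfTypeAt_holTwoForm (j k : Fin 4) : IsOfTypeAt 2 0 (holTwoForm j k) := by
  refine ⟨rfl, fun θ v ↦ ?_⟩
  have hexp : cexp ((((2 : ℕ) : ℤ) - ((0 : ℕ) : ℤ) : ℤ) * θ * I) = cexp (θ * I) * cexp (θ * I) := by
    rw [← Complex.exp_add]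
    congr 1
    push_cast
    ring
  rw [hexp, holTwoForm_apply, holTwoForm_apply]
  simp only [Pi.smul_apply, smul_eq_mul]
  ring

/-! ### §4 `B³(X) = 0` for the explicit torus of Weil type: no analytic curve -/

set_option maxHeartbeats 800000 in
/-- **`H⁶(X, ℚ) ∩ H^{3,3}(X) = 0` for the explicit complex torus of Weil type `X = ℂ⁴/Φ(ℤ⁸)`, `Φ = Weil.periodEquiv`**
(no non-zero rational class of type `(p,p)` in degree `6`): by the criterion `hodgeClassesIn_eq_bot_of_forall`, it
suffices that an antisymmetric rational `8 × 8` matrix `Q` annihilated by the holomorphic `2`-forms vanishes; testing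
against `dz₀ ∧ dz₁`, `dz₀ ∧ dz₂`, `dz₀ ∧ dz₃`, `dz₁ ∧ dz₂` on the period matrix `Weil.periodEquiv_single` and separating
the coefficients of the powers of the real transcendental period `t` (`eq_zero_of_sum_add_I_mul_sum_eq_zero`) yields
`60` linear equations which force `Q = 0`. This is the degree-`6` companion of `NS(X) ⊗ ℚ = 0`
(`Weil.eq_zero_of_mem_span_coordForm_of_smul_I`) for Voisin's general torus of Weil type, for the tree's explicit
very general member. [cite: Voisin2002KaehlerCounterexample, §2 (a)–(b) and §3 Prop. 3] [cite: VoisinHodgeI2002, §7.3.2 Lemma 7.30] -/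
theorem hodgeClassesIn_six_eq_bot (p : ℕ) : hodgeClassesIn periodEquiv 6 p = ⊥ := by
  refine hodgeClassesIn_eq_bot_of_forall periodEquiv (Equiv.refl (Fin 8)) (by norm_num) fun Q hanti hsum ↦ ?_
  have hdiag : ∀ a, Q a a = 0 := fun a ↦ by
    have h1 := hanti a a
    linarith
  set t : ℂ := (tV : ℂ) with ht
  -- the identity from the holomorphic 2-form dz0 ∧ dz1
  set α01 : ℕ → ℚ := fun n ↦ if n = 0 then 2 * Q 0 2 - 2 * Q 1 3 else if n = 1 then -2 * Q 2 4 + 2 * Q 3 5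
      else if n = 2 then -2 * Q 2 6 + 2 * Q 3 7 else if n = 3 then 2 * Q 0 4 - 2 * Q 1 5 else if n = 5 then 2 * Q 0 6 -
      2 * Q 1 7 - 2 * Q 4 6 + 2 * Q 5 7 else 2 * Q 4 6 - 2 * Q 5 7 with hα01
  set β01 : ℕ → ℚ := fun n ↦ if n = 0 then 2 * Q 0 3 + 2 * Q 1 2 else if n = 1 then -2 * Q 2 5 - 2 * Q 3 4
      else if n = 2 then -2 * Q 2 7 - 2 * Q 3 6 else if n = 3 then 2 * Q 0 5 + 2 * Q 1 4 else if n = 5 then 2 * Q 0 7 +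
      2 * Q 1 6 - 2 * Q 4 7 - 2 * Q 5 6 else 2 * Q 4 7 + 2 * Q 5 6 with hβ01
  have key01 : (∑ n ∈ ({0, 1, 2, 3, 5, 6} : Finset ℕ), ((α01 n : ℚ) : ℂ) * (tV : ℂ) ^ n) +
      I * (∑ n ∈ ({0, 1, 2, 3, 5, 6} : Finset ℕ), ((β01 n : ℚ) : ℂ) * (tV : ℂ) ^ n) = 0 := by
    have h := hsum (holTwoForm 0 1) (isOfTypeAt_holTwoForm 0 1)
    simp only [Fin.sum_univ_eight, holTwoForm_apply, Matrix.cons_val_zero, Matrix.cons_val_one,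
      Matrix.cons_val, periodEquiv_single, hdiag, hanti 0 1, hanti 0 2, hanti 0 3, hanti 0 4,
      hanti 0 5, hanti 0 6, hanti 0 7, hanti 1 2, hanti 1 3, hanti 1 4, hanti 1 5, hanti 1 6, hanti 1 7, hanti 2 3,
      hanti 2 4, hanti 2 5, hanti 2 6, hanti 2 7, hanti 3 4, hanti 3 5, hanti 3 6, hanti 3 7, hanti 4 5, hanti 4 6,
      hanti 4 7, hanti 5 6, hanti 5 7, hanti 6 7, Rat.cast_zero, Rat.cast_neg,
      mul_zero, zero_mul, mul_neg, neg_mul, neg_neg, add_zero, zero_add, sub_zero, zero_sub] at h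
    norm_num [hα01, hβ01]
    linear_combination h - ((2 * (Q 1 3 : ℂ)) + (-2 * (Q 3 5 : ℂ)) * (tV : ℂ) + (-2 * (Q 3 7 : ℂ)) * (tV : ℂ) ^ 2 +
      (2 * (Q 1 5 : ℂ)) * (tV : ℂ) ^ 3 + (2 * (Q 1 7 : ℂ) - 2 * (Q 5 7 : ℂ)) * (tV : ℂ) ^ 5 +
      (2 * (Q 5 7 : ℂ)) * (tV : ℂ) ^ 6) * Complex.I_sq
  obtain ⟨A01, B01⟩ := eq_zero_of_sum_add_I_mul_sum_eq_zero transcendental_tV_complex _ _ _ _ key01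
  have a01_0 : 2 * Q 0 2 - 2 * Q 1 3 = 0 := by simpa [hα01] using A01 0 (by simp)
  have a01_1 : -2 * Q 2 4 + 2 * Q 3 5 = 0 := by simpa [hα01] using A01 1 (by simp)
  have a01_2 : -2 * Q 2 6 + 2 * Q 3 7 = 0 := by simpa [hα01] using A01 2 (by simp)
  have a01_3 : 2 * Q 0 4 - 2 * Q 1 5 = 0 := by simpa [hα01] using A01 3 (by simp)
  have a01_5 : 2 * Q 0 6 - 2 * Q 1 7 - 2 * Q 4 6 + 2 * Q 5 7 = 0 := by simpa [hα01] using A01 5 (by simp)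
  have a01_6 : 2 * Q 4 6 - 2 * Q 5 7 = 0 := by simpa [hα01] using A01 6 (by simp)
  have b01_0 : 2 * Q 0 3 + 2 * Q 1 2 = 0 := by simpa [hβ01] using B01 0 (by simp)
  have b01_1 : -2 * Q 2 5 - 2 * Q 3 4 = 0 := by simpa [hβ01] using B01 1 (by simp)
  have b01_2 : -2 * Q 2 7 - 2 * Q 3 6 = 0 := by simpa [hβ01] using B01 2 (by simp)
  have b01_3 : 2 * Q 0 5 + 2 * Q 1 4 = 0 := by simpa [hβ01] using B01 3 (by simp)
  have b01_5 : 2 * Q 0 7 + 2 * Q 1 6 - 2 * Q 4 7 - 2 * Q 5 6 = 0 := by simpa [hβ01] using B01 5 (by simp)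
  have b01_6 : 2 * Q 4 7 + 2 * Q 5 6 = 0 := by simpa [hβ01] using B01 6 (by simp)
  -- the identity from the holomorphic 2-form dz0 ∧ dz2
  set α02 : ℕ → ℚ := fun n ↦ if n = 0 then 2 * Q 0 4 + 2 * Q 1 5 else if n = 2 then -2 * Q 4 6 - 2 * Q 5 7
      else if n = 11 then -2 * Q 0 4 - 2 * Q 1 5 else if n = 12 then -2 * Q 0 6 - 2 * Q 1 7
      else if n = 20 then 2 * Q 0 2 + 2 * Q 1 3 else if n = 21 then -2 * Q 2 4 - 2 * Q 3 5 else -2 * Q 2 6 -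
      2 * Q 3 7 with hα02
  set β02 : ℕ → ℚ := fun n ↦ if n = 0 then -2 * Q 0 5 + 2 * Q 1 4 else if n = 1 then -4 * Q 4 5
      else if n = 2 then -2 * Q 4 7 + 2 * Q 5 6 else if n = 10 then -4 * Q 0 1 else if n = 11 then -2 * Q 0 5 +
      2 * Q 1 4 else if n = 12 then -2 * Q 0 7 + 2 * Q 1 6 else if n = 20 then -2 * Q 0 3 + 2 * Q 1 2
      else if n = 21 then -2 * Q 2 5 + 2 * Q 3 4 else -2 * Q 2 7 + 2 * Q 3 6 with hβ02
  have key02 : (∑ n ∈ ({0, 2, 11, 12, 20, 21, 22} : Finset ℕ), ((α02 n : ℚ) : ℂ) * (tV : ℂ) ^ n) +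
      I * (∑ n ∈ ({0, 1, 2, 10, 11, 12, 20, 21, 22} : Finset ℕ), ((β02 n : ℚ) : ℂ) * (tV : ℂ) ^ n) = 0 := by
    have h := hsum (holTwoForm 0 2) (isOfTypeAt_holTwoForm 0 2)
    simp only [Fin.sum_univ_eight, holTwoForm_apply, Matrix.cons_val_zero, Matrix.cons_val_one,
      Matrix.cons_val, periodEquiv_single, hdiag, hanti 0 1, hanti 0 2, hanti 0 3, hanti 0 4,
      hanti 0 5, hanti 0 6, hanti 0 7, hanti 1 2, hanti 1 3, hanti 1 4, hanti 1 5, hanti 1 6, hanti 1 7, hanti 2 3,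
      hanti 2 4, hanti 2 5, hanti 2 6, hanti 2 7, hanti 3 4, hanti 3 5, hanti 3 6, hanti 3 7, hanti 4 5, hanti 4 6,
      hanti 4 7, hanti 5 6, hanti 5 7, hanti 6 7, Rat.cast_zero, Rat.cast_neg,
      mul_zero, zero_mul, mul_neg, neg_mul, neg_neg, add_zero, zero_add, sub_zero, zero_sub] at h
    norm_num [hα02, hβ02]
    linear_combination h - ((-2 * (Q 1 5 : ℂ)) + (2 * (Q 5 7 : ℂ)) * (tV : ℂ) ^ 2 + (2 * (Q 1 5 : ℂ)) * (tV : ℂ) ^ 11 +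
      (2 * (Q 1 7 : ℂ)) * (tV : ℂ) ^ 12 + (-2 * (Q 1 3 : ℂ)) * (tV : ℂ) ^ 20 + (2 * (Q 3 5 : ℂ)) * (tV : ℂ) ^ 21 +
      (2 * (Q 3 7 : ℂ)) * (tV : ℂ) ^ 22) * Complex.I_sq
  obtain ⟨A02, B02⟩ := eq_zero_of_sum_add_I_mul_sum_eq_zero transcendental_tV_complex _ _ _ _ key02
  have a02_0 : 2 * Q 0 4 + 2 * Q 1 5 = 0 := by simpa [hα02] using A02 0 (by simp)
  have a02_2 : -2 * Q 4 6 - 2 * Q 5 7 = 0 := by simpa [hα02] using A02 2 (by simp)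
  have a02_12 : -2 * Q 0 6 - 2 * Q 1 7 = 0 := by simpa [hα02] using A02 12 (by simp)
  have a02_20 : 2 * Q 0 2 + 2 * Q 1 3 = 0 := by simpa [hα02] using A02 20 (by simp)
  have a02_21 : -2 * Q 2 4 - 2 * Q 3 5 = 0 := by simpa [hα02] using A02 21 (by simp)
  have a02_22 : -2 * Q 2 6 - 2 * Q 3 7 = 0 := by simpa [hα02] using A02 22 (by simp)
  have b02_0 : -2 * Q 0 5 + 2 * Q 1 4 = 0 := by simpa [hβ02] using B02 0 (by simp)
  have b02_1 : -4 * Q 4 5 = 0 := by simpa [hβ02] using B02 1 (by simp)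
  have b02_2 : -2 * Q 4 7 + 2 * Q 5 6 = 0 := by simpa [hβ02] using B02 2 (by simp)
  have b02_10 : -4 * Q 0 1 = 0 := by simpa [hβ02] using B02 10 (by simp)
  have b02_12 : -2 * Q 0 7 + 2 * Q 1 6 = 0 := by simpa [hβ02] using B02 12 (by simp)
  have b02_20 : -2 * Q 0 3 + 2 * Q 1 2 = 0 := by simpa [hβ02] using B02 20 (by simp)
  have b02_21 : -2 * Q 2 5 + 2 * Q 3 4 = 0 := by simpa [hβ02] using B02 21 (by simp)
  have b02_22 : -2 * Q 2 7 + 2 * Q 3 6 = 0 := by simpa [hβ02] using B02 22 (by simp)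
  -- the identity from the holomorphic 2-form dz0 ∧ dz3
  set α03 : ℕ → ℚ := fun n ↦ if n = 0 then 2 * Q 0 6 + 2 * Q 1 7 else if n = 1 then 2 * Q 4 6 + 2 * Q 5 7
      else if n = 31 then -2 * Q 0 4 - 2 * Q 1 5 else if n = 32 then -2 * Q 0 6 - 2 * Q 1 7
      else if n = 50 then 2 * Q 0 2 + 2 * Q 1 3 else if n = 51 then -2 * Q 2 4 - 2 * Q 3 5 else -2 * Q 2 6 -
      2 * Q 3 7 with hα03
  set β03 : ℕ → ℚ := fun n ↦ if n = 0 then -2 * Q 0 7 + 2 * Q 1 6 else if n = 1 then -2 * Q 4 7 + 2 * Q 5 6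
      else if n = 2 then -4 * Q 6 7 else if n = 30 then -4 * Q 0 1 else if n = 31 then -2 * Q 0 5 + 2 * Q 1 4
      else if n = 32 then -2 * Q 0 7 + 2 * Q 1 6 else if n = 50 then -2 * Q 0 3 + 2 * Q 1 2
      else if n = 51 then -2 * Q 2 5 + 2 * Q 3 4 else -2 * Q 2 7 + 2 * Q 3 6 with hβ03
  have key03 : (∑ n ∈ ({0, 1, 31, 32, 50, 51, 52} : Finset ℕ), ((α03 n : ℚ) : ℂ) * (tV : ℂ) ^ n) +
      I * (∑ n ∈ ({0, 1, 2, 30, 31, 32, 50, 51, 52} : Finset ℕ), ((β03 n : ℚ) : ℂ) * (tV : ℂ) ^ n) = 0 := by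
    have h := hsum (holTwoForm 0 3) (isOfTypeAt_holTwoForm 0 3)
    simp only [Fin.sum_univ_eight, holTwoForm_apply, Matrix.cons_val_zero, Matrix.cons_val_one,
      Matrix.cons_val, periodEquiv_single, hdiag, hanti 0 1, hanti 0 2, hanti 0 3, hanti 0 4,
      hanti 0 5, hanti 0 6, hanti 0 7, hanti 1 2, hanti 1 3, hanti 1 4, hanti 1 5, hanti 1 6, hanti 1 7, hanti 2 3,
      hanti 2 4, hanti 2 5, hanti 2 6, hanti 2 7, hanti 3 4, hanti 3 5, hanti 3 6, hanti 3 7, hanti 4 5, hanti 4 6,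
      hanti 4 7, hanti 5 6, hanti 5 7, hanti 6 7, Rat.cast_zero, Rat.cast_neg,
      mul_zero, zero_mul, mul_neg, neg_mul, neg_neg, add_zero, zero_add, sub_zero, zero_sub] at h
    norm_num [hα03, hβ03]
    linear_combination h - ((-2 * (Q 1 7 : ℂ)) + (-2 * (Q 5 7 : ℂ)) * (tV : ℂ) + (2 * (Q 1 5 : ℂ)) * (tV : ℂ) ^ 31 +
      (2 * (Q 1 7 : ℂ)) * (tV : ℂ) ^ 32 + (-2 * (Q 1 3 : ℂ)) * (tV : ℂ) ^ 50 + (2 * (Q 3 5 : ℂ)) * (tV : ℂ) ^ 51 +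
      (2 * (Q 3 7 : ℂ)) * (tV : ℂ) ^ 52) * Complex.I_sq
  obtain ⟨-, B03⟩ := eq_zero_of_sum_add_I_mul_sum_eq_zero transcendental_tV_complex _ _ _ _ key03
  have b03_2 : -4 * Q 6 7 = 0 := by simpa [hβ03] using B03 2 (by simp)
  -- the identity from the holomorphic 2-form dz1 ∧ dz2
  set α12 : ℕ → ℚ := fun n ↦ if n = 0 then 2 * Q 2 4 + 2 * Q 3 5 else if n = 5 then -2 * Q 4 6 - 2 * Q 5 7
      else if n = 10 then -2 * Q 0 2 - 2 * Q 1 3 else if n = 13 then -2 * Q 0 4 - 2 * Q 1 5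
      else if n = 15 then -2 * Q 0 6 - 2 * Q 1 7 else if n = 23 then -2 * Q 2 4 - 2 * Q 3 5 else -2 * Q 2 6 -
      2 * Q 3 7 with hα12
  set β12 : ℕ → ℚ := fun n ↦ if n = 0 then -2 * Q 2 5 + 2 * Q 3 4 else if n = 3 then -4 * Q 4 5
      else if n = 5 then -2 * Q 4 7 + 2 * Q 5 6 else if n = 10 then -2 * Q 0 3 + 2 * Q 1 2
      else if n = 13 then -2 * Q 0 5 + 2 * Q 1 4 else if n = 15 then -2 * Q 0 7 + 2 * Q 1 6
      else if n = 20 then -4 * Q 2 3 else if n = 23 then -2 * Q 2 5 + 2 * Q 3 4 else -2 * Q 2 7 + 2 * Q 3 6 with hβ12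
  have key12 : (∑ n ∈ ({0, 5, 10, 13, 15, 23, 25} : Finset ℕ), ((α12 n : ℚ) : ℂ) * (tV : ℂ) ^ n) +
      I * (∑ n ∈ ({0, 3, 5, 10, 13, 15, 20, 23, 25} : Finset ℕ), ((β12 n : ℚ) : ℂ) * (tV : ℂ) ^ n) = 0 := by
    have h := hsum (holTwoForm 1 2) (isOfTypeAt_holTwoForm 1 2)
    simp only [Fin.sum_univ_eight, holTwoForm_apply, Matrix.cons_val_zero, Matrix.cons_val_one,
      Matrix.cons_val, periodEquiv_single, hdiag, hanti 0 1, hanti 0 2, hanti 0 3, hanti 0 4,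
      hanti 0 5, hanti 0 6, hanti 0 7, hanti 1 2, hanti 1 3, hanti 1 4, hanti 1 5, hanti 1 6, hanti 1 7, hanti 2 3,
      hanti 2 4, hanti 2 5, hanti 2 6, hanti 2 7, hanti 3 4, hanti 3 5, hanti 3 6, hanti 3 7, hanti 4 5, hanti 4 6,
      hanti 4 7, hanti 5 6, hanti 5 7, hanti 6 7, Rat.cast_zero, Rat.cast_neg,
      mul_zero, zero_mul, mul_neg, neg_mul, neg_neg, add_zero, zero_add, sub_zero, zero_sub] at h
    norm_num [hα12, hβ12]
    linear_combination h - ((-2 * (Q 3 5 : ℂ)) + (2 * (Q 5 7 : ℂ)) * (tV : ℂ) ^ 5 + (2 * (Q 1 3 : ℂ)) * (tV : ℂ) ^ 10 +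
      (2 * (Q 1 5 : ℂ)) * (tV : ℂ) ^ 13 + (2 * (Q 1 7 : ℂ)) * (tV : ℂ) ^ 15 + (2 * (Q 3 5 : ℂ)) * (tV : ℂ) ^ 23 +
      (2 * (Q 3 7 : ℂ)) * (tV : ℂ) ^ 25) * Complex.I_sq
  obtain ⟨-, B12⟩ := eq_zero_of_sum_add_I_mul_sum_eq_zero transcendental_tV_complex _ _ _ _ key12
  have b12_20 : -4 * Q 2 3 = 0 := by simpa [hβ12] using B12 20 (by simp)
  -- all 28 rational coordinates vanish
  have q01 : Q 0 1 = 0 := by linear_combination (-1/4) * b02_10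
  have q02 : Q 0 2 = 0 := by linear_combination (1/4) * a01_0 + (1/4) * a02_20
  have q03 : Q 0 3 = 0 := by linear_combination (1/4) * b01_0 + (-1/4) * b02_20
  have q04 : Q 0 4 = 0 := by linear_combination (1/4) * a01_3 + (1/4) * a02_0
  have q05 : Q 0 5 = 0 := by linear_combination (1/4) * b01_3 + (-1/4) * b02_0
  have q06 : Q 0 6 = 0 := by linear_combination (1/4) * a01_5 + (1/4) * a01_6 + (-1/4) * a02_12
  have q07 : Q 0 7 = 0 := by linear_combination (1/4) * b01_5 + (1/4) * b01_6 + (-1/4) * b02_12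
  have q12 : Q 1 2 = 0 := by linear_combination (1/4) * b01_0 + (1/4) * b02_20
  have q13 : Q 1 3 = 0 := by linear_combination (-1/4) * a01_0 + (1/4) * a02_20
  have q14 : Q 1 4 = 0 := by linear_combination (1/4) * b01_3 + (1/4) * b02_0
  have q15 : Q 1 5 = 0 := by linear_combination (-1/4) * a01_3 + (1/4) * a02_0
  have q16 : Q 1 6 = 0 := by linear_combination (1/4) * b01_5 + (1/4) * b01_6 + (1/4) * b02_12
  have q17 : Q 1 7 = 0 := by linear_combination (-1/4) * a01_5 + (-1/4) * a01_6 + (-1/4) * a02_12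
  have q23 : Q 2 3 = 0 := by linear_combination (-1/4) * b12_20
  have q24 : Q 2 4 = 0 := by linear_combination (-1/4) * a01_1 + (-1/4) * a02_21
  have q25 : Q 2 5 = 0 := by linear_combination (-1/4) * b01_1 + (-1/4) * b02_21
  have q26 : Q 2 6 = 0 := by linear_combination (-1/4) * a01_2 + (-1/4) * a02_22
  have q27 : Q 2 7 = 0 := by linear_combination (-1/4) * b01_2 + (-1/4) * b02_22
  have q34 : Q 3 4 = 0 := by linear_combination (-1/4) * b01_1 + (1/4) * b02_21
  have q35 : Q 3 5 = 0 := by linear_combination (1/4) * a01_1 + (-1/4) * a02_21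
  have q36 : Q 3 6 = 0 := by linear_combination (-1/4) * b01_2 + (1/4) * b02_22
  have q37 : Q 3 7 = 0 := by linear_combination (1/4) * a01_2 + (-1/4) * a02_22
  have q45 : Q 4 5 = 0 := by linear_combination (-1/4) * b02_1
  have q46 : Q 4 6 = 0 := by linear_combination (1/4) * a01_6 + (-1/4) * a02_2
  have q47 : Q 4 7 = 0 := by linear_combination (1/4) * b01_6 + (-1/4) * b02_2
  have q56 : Q 5 6 = 0 := by linear_combination (1/4) * b01_6 + (1/4) * b02_2
  have q57 : Q 5 7 = 0 := by linear_combination (-1/4) * a01_6 + (-1/4) * a02_2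
  have q67 : Q 6 7 = 0 := by linear_combination (-1/4) * b03_2
  -- conclusion
  have hall : ∀ a b : Fin 8, a < b → Q a b = 0 := by
    intro a b
    fin_cases a <;> fin_cases b <;> first | (intro; assumption) | (intro hlt; exact absurd hlt (by decide))
  intro a b
  rcases lt_trichotomy a b with hab | rfl | hba
  · exact hall a b hab
  · exact hdiag a
  · rw [hanti b a, hall b a hba, neg_zero]

/-- **`B³(X) = H⁶(X, ℚ) ∩ H^{3,3}(X) = 0`** for the explicit torus of Weil type: no non-zero rational Hodge class of
codimension three. [cite: Voisin2002KaehlerCounterexample, §2 (a)–(b) and §3 Prop. 3] -/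
theorem hodgeClasses_three_eq_bot : hodgeClasses periodEquiv 3 = ⊥ :=
  hodgeClassesIn_six_eq_bot 3

/-- **The explicit complex torus of Weil type `X = ℂ⁴/Φ(ℤ⁸)` carries NO ANALYTIC CURVE**: no closed analytic subset
of pure dimension one (its class would be a non-zero integral Hodge class in `H⁶(X, ℤ) ∩ H^{3,3} ⊆ B³(X) = 0`;
the cycle-class obstruction `not_hasPureDim_of_hodgeClasses_eq_bot`, valid in the sup-normed model). The curve case
of Voisin's assumption (b) for the tree's explicit torus. [cite: Voisin2002KaehlerCounterexample, §2 (b) and §3 p. 1063] [cite: GriffithsHarrisPrinciples1978, Ch. 0 §2 and Ch. 3 §1] -/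
theorem not_hasPureDim_one (Z : Set (ComplexTorus periodEquiv)) : ¬ HasPureDim 𝓘(ℂ, Fin 4 → ℂ) Z 1 :=
  not_hasPureDim_of_hodgeClasses_eq_bot periodEquiv (n := 8) (d := 1) (p := 3) (Equiv.refl (Fin 8))
    (by norm_num) hodgeClasses_three_eq_bot Z

/-- Codimension form: the explicit torus of Weil type has no closed analytic subset of pure codimension three.
[cite: Voisin2002KaehlerCounterexample, §2 (b) and §3 p. 1063] -/
theorem not_hasPureCodim_three (Z : Set (ComplexTorus periodEquiv)) : ¬ HasPureCodim 𝓘(ℂ, Fin 4 → ℂ) Z 3 :=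
  not_hasPureCodim_of_hodgeClasses_eq_bot periodEquiv (n := 8) (d := 1) (p := 3) (Equiv.refl (Fin 8))
    (by norm_num) (by simp) hodgeClasses_three_eq_bot Z

/-- **Neither curves nor hypersurfaces**: together with `Weil.not_hasPureDim_three` (no divisor, from `NS(X) ⊗ ℚ = 0`),
the explicit torus of Weil type has no closed analytic subset of pure dimension `1` or `3`.
[cite: Voisin2002KaehlerCounterexample, §2 (b) and §3 Prop. 3] -/
theorem not_hasPureDim_one_and_three (Z : Set (ComplexTorus periodEquiv)) :
    ¬ HasPureDim 𝓘(ℂ, Fin 4 → ℂ) Z 1 ∧ ¬ HasPureDim 𝓘(ℂ, Fin 4 → ℂ) Z 3 :=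
  ⟨not_hasPureDim_one Z, not_hasPureDim_three Z⟩

end Weil

end Literature.Geometry.Kaehler

end
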